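import Literature.NumberTheory.LFunctions.GaussianHeckeRayMisprint
import Literature.NumberTheory.LFunctions.GaussianHeckeContentMoment
import HarnessLib

/-!
# The printed ray-sum display of Harman 2007, Lemma 11.2 / JT 2024, Lemma 3.2 is FALSE — proof layer

Topic `Literature/NumberTheory/LFunctions`.  PROOF LAYER for the statement file
`GaussianHeckeRayMisprint.lean`: theorems only (the helpers are `private`), no definitions, no named
facts.  Main result:

* `GaussianInt.not_Harman2007_lemma112_printed : ¬ Harman2007_lemma112_printed` — the display
  `∑'_{N(n) ≤ N} |a_n'|² ≪ N ∑_{N(n) ≤ N} |a_n|² τ(n)/N(n)` (Harman 2007, Lemma 11.2, first display,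
  held print p0205 L37–L41; Järviniemi–Teräväinen 2024 = arXiv:2303.05822 (held TeX source, version
  number not recorded in the holding), Lemma 3.2, second display, p0009 L26–L28), typed verbatim with an
  absolute constant quantified first, is false.

## The witness (of record: module docstring of `GaussianHeckeMeanValue.lean`, ll. 65–79)

Given the constant `C`, put `C' = max C 1`, `M = ⌈32¹⁷ C'⌉ + 1`, `K = M³²`, `N = K²`, and let `a` be
the indicator of the rational integers `k` with `K/2 < k ≤ K`, viewed in `ℤ[i]*` (they have argument
`0`, norm `k² ≤ N`, and lie on the ray of the single primitive point `n = 1`).  Then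

* left side `≥ |a_1'|² = #{K/2 < k ≤ K}² ≥ (K/2)²` (`rayCoeff_one_indicator`);
* right side `= C N ∑_{K/2 < k ≤ K} τ(k)/k² ≤ C' K² · (8/K) (1 + log K)¹⁶ = 8 C' K (1 + log K)¹⁶`
  (`sum_window_card_divisorsStar_div_norm_le`), because for a rational integer `k ≥ 1` the number of
  its divisors in `ℤ[i]*` is `τ(k) ≤ 4 d(k)⁴` (tree theorem `GaussianHecke.card_divisorsStar_natCast_le`:
  norms of divisors divide `k²`, `r(n) ≤ 4 d(n)`, `d(k²) ≤ d(k)²`), `k² > k K/2` on the window, and the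
  rational fourth divisor moment is `∑_{k ≤ K} d(k)⁴/k ≤ (1 + log K)¹⁶` (tree theorem
  `GaussianHecke.divisorMoment_le`, from `D_{j+1} ≤ D_j²` and `D_0 = H_K ≤ 1 + log K`);
* so `K ≤ 32 C' (1 + log K)¹⁶ ≤ 32 C' (32 M)¹⁶ = 32¹⁷ C' M¹⁶` (as `log K = 32 log M ≤ 32 (M − 1)`),
  contradicting `K = M³² ≥ M · M¹⁶ > 32¹⁷ C' M¹⁶`.

The window divisor-sum estimate `∑_{K/2 < k ≤ K} τ_{ℤ[i]*}(k) = o(K²)` is the whole content; a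
finite check cannot refute an existential constant, and the trivial bound `τ(k) ≤ 2k` only gives order
`K²`, which `C` absorbs.  UNAFFECTED: Lemma 11.1 = JT Lemma 3.2 first display
(`JarviniemiTeravainen2024_heckeMVT_holds`), Harman's "in particular" clause (divisor-bounded
coefficients), and the corrected ray inequality `GaussianInt.sum_norm_rayCoeff_sq_le`.

## References

* G. Harman, *Prime-Detecting Sieves*, LMS Monographs 33 (2007), Lemma 11.2 [Harman2007].
* O. Järviniemi, J. Teräväinen, *Gaussian almost primes in almost all narrow sectors*,
  Rev. Mat. Iberoam. 40 (2024) = arXiv:2303.05822, Lemma 3.2 [JarviniemiTeravainen2024].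
-/

noncomputable section

open Complex Finset
open scoped Real

namespace Literature.NumberTheory.LFunctions.GaussianInt

open GaussianHecke (divisorsStar card_divisorsStar_natCast_le divisorMoment_le)

/-! ### The witness: the rational integers `K/2 < k ≤ K` on the ray of `1` -/

/-- A positive rational integer `k ≤ K`, viewed in `ℤ[i]`, lies on the ray of the primitive point `1`
inside `{v ∈ ℤ[i]* : N(v) ≤ K²}` (argument `0`, norm `k²`). [folklore] -/
private theorem natCast_mem_rayStar {K k : ℕ} (hk : 0 < k) (hkK : k ≤ K) :
    (k : GaussianInt) ∈ rayStar ((K : ℝ) ^ 2) 1 := by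
  rw [mem_rayStar, mem_normLEStar, mem_firstQuadrant, Zsqrtd.norm_natCast, Zsqrtd.re_natCast,
    Zsqrtd.im_natCast]
  have hkK' : (k : ℝ) ≤ K := by exact_mod_cast hkK
  have hk0 : (0 : ℝ) ≤ k := Nat.cast_nonneg k
  refine ⟨⟨?_, by exact_mod_cast hk, le_rfl⟩, ?_⟩
  · push_cast
    nlinarith
  · rw [show ((k : GaussianInt) : ℂ) = ((k : ℕ) : ℂ) from map_natCast GaussianInt.toComplex k,
      show ((1 : GaussianInt) : ℂ) = (1 : ℂ) from map_one GaussianInt.toComplex,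
      Complex.natCast_arg, Complex.arg_one]

/-- The window `{K/2 < k ≤ K}` of rational integers, pushed into `ℤ[i]`, lies on the ray of `1` inside
`{v ∈ ℤ[i]* : N(v) ≤ K²}`. [folklore] -/
private theorem image_Ioc_subset_rayStar (K : ℕ) :
    (Ioc (K / 2) K).image (Nat.cast : ℕ → GaussianInt) ⊆ rayStar ((K : ℝ) ^ 2) 1 := by
  intro v hv
  obtain ⟨k, hk, rfl⟩ := mem_image.1 hv
  rw [mem_Ioc] at hk
  exact natCast_mem_rayStar (by omega) hk.2

/-- The ray sum `a_1'` of the indicator of a finite set `T` lying on the ray of `1` is `#T`. [folklore] -/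
private theorem rayCoeff_one_indicator {N : ℝ} {T : Finset GaussianInt} (hT : T ⊆ rayStar N 1) :
    rayCoeff N (fun v ↦ if v ∈ T then (1 : ℂ) else 0) 1 = T.card := by
  rw [rayCoeff_eq_sum_rayStar, Finset.sum_boole, Finset.filter_mem_eq_inter,
    Finset.inter_eq_right.2 hT]

/-- For the indicator `a` of a finite set `T ⊆ {v ∈ ℤ[i]* : N(v) ≤ N}`, the weight sum
`∑_{N(v) ≤ N} |a_v|² τ(v)/N(v)` is `∑_{v ∈ T} τ(v)/N(v)`. [folklore] -/
private theorem sum_indicator_weight {N : ℝ} {T : Finset GaussianInt} (hT : T ⊆ normLEStar N) :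
    ∑ v ∈ normLEStar N, ‖(if v ∈ T then (1 : ℂ) else 0)‖ ^ 2 *
        ((divisorsStar v).card : ℝ) / (v.norm : ℝ) =
      ∑ v ∈ T, ((divisorsStar v).card : ℝ) / (v.norm : ℝ) := by
  have h : ∀ v ∈ normLEStar N, ‖(if v ∈ T then (1 : ℂ) else 0)‖ ^ 2 *
      ((divisorsStar v).card : ℝ) / (v.norm : ℝ) =
      if v ∈ T then ((divisorsStar v).card : ℝ) / (v.norm : ℝ) else 0 := by
    intro v _
    split_ifs <;> simp
  rw [sum_congr rfl h, Finset.sum_ite_mem, Finset.inter_eq_right.2 hT]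

/-! ### The window divisor sum -/

/-- **The window divisor-sum estimate.** For `K ≥ 1`,
`∑_{K/2 < k ≤ K} τ(k)/N(k) ≤ (8/K) (1 + log K)¹⁶`, where `τ(k) = #{d ∈ ℤ[i]* : d ∣ k}` and
`N(k) = k²`: `τ(k) ≤ 4 d(k)⁴` (`GaussianHecke.card_divisorsStar_natCast_le`), `k² > k K/2` on the
window, and `∑_{k ≤ K} d(k)⁴/k ≤ (1 + log K)¹⁶` (`GaussianHecke.divisorMoment_le`). [folklore] -/
private theorem sum_window_card_divisorsStar_div_norm_le {K : ℕ} (hK : 1 ≤ K) :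
    ∑ k ∈ Ioc (K / 2) K,
        ((divisorsStar (k : GaussianInt)).card : ℝ) / (((k : GaussianInt)).norm : ℝ) ≤
      8 / K * (1 + Real.log K) ^ 16 := by
  have hK' : (0 : ℝ) < K := by exact_mod_cast hK
  have hmom : ∑ k ∈ Icc 1 K, ((k.divisors.card : ℝ)) ^ 4 / k ≤ (1 + Real.log K) ^ 16 := by
    have h := divisorMoment_le K 4
    rwa [show (2 : ℕ) ^ 4 = 16 by norm_num] at h
  calc ∑ k ∈ Ioc (K / 2) K,
        ((divisorsStar (k : GaussianInt)).card : ℝ) / (((k : GaussianInt)).norm : ℝ)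
      ≤ ∑ k ∈ Ioc (K / 2) K, 8 / K * (((k.divisors.card : ℝ)) ^ 4 / k) := by
        refine sum_le_sum fun k hk ↦ ?_
        rw [mem_Ioc] at hk
        have hk0 : k ≠ 0 := by omega
        have hkpos : (0 : ℝ) < k := by exact_mod_cast Nat.pos_of_ne_zero hk0
        have h2k : (K : ℝ) < 2 * k := by
          have : K < 2 * k := by omega
          exact_mod_cast this
        have hτ : ((divisorsStar (k : GaussianInt)).card : ℝ) ≤ 4 * (k.divisors.card : ℝ) ^ 4 := by
          exact_mod_cast card_divisorsStar_natCast_le hk0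
        have hnorm : (((k : GaussianInt)).norm : ℝ) = (k : ℝ) * k := by
          rw [Zsqrtd.norm_natCast]; push_cast; ring
        have hd : (0 : ℝ) ≤ (k.divisors.card : ℝ) ^ 4 := by positivity
        rw [hnorm, div_le_iff₀ (by positivity)]
        have hkey : 8 / (K : ℝ) * ((k.divisors.card : ℝ) ^ 4 / k) * (k * k) =
            (8 * k / K) * (k.divisors.card : ℝ) ^ 4 := by
          field_simp
        rw [hkey]
        have h4 : (4 : ℝ) ≤ 8 * k / K := by
          rw [le_div_iff₀ hK']; linarith
        calc ((divisorsStar (k : GaussianInt)).card : ℝ) ≤ 4 * (k.divisors.card : ℝ) ^ 4 := hτ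
          _ ≤ (8 * k / K) * (k.divisors.card : ℝ) ^ 4 := mul_le_mul_of_nonneg_right h4 hd
    _ = 8 / K * ∑ k ∈ Ioc (K / 2) K, ((k.divisors.card : ℝ)) ^ 4 / k := by rw [mul_sum]
    _ ≤ 8 / K * ∑ k ∈ Icc 1 K, ((k.divisors.card : ℝ)) ^ 4 / k := by
        have hsub : Ioc (K / 2) K ⊆ Icc 1 K := by
          intro k hk
          rw [mem_Ioc] at hk
          rw [mem_Icc]; omega
        have h8 : (0 : ℝ) ≤ 8 / K := by positivity
        exact mul_le_mul_of_nonneg_left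
          (sum_le_sum_of_subset_of_nonneg hsub fun k _ _ ↦ by positivity) h8
    _ ≤ 8 / K * (1 + Real.log K) ^ 16 := by
        have h8 : (0 : ℝ) ≤ 8 / K := by positivity
        exact mul_le_mul_of_nonneg_left hmom h8

/-! ### The refutation -/

/-- **The printed display is FALSE** (Harman 2007, Lemma 11.2, first display = Järviniemi–Teräväinen
2024, Lemma 3.2, second display, typed verbatim as `Harman2007_lemma112_printed` with an ABSOLUTE
constant quantified first): there is NO constant `C` with
`∑'_{N(n) ≤ N} |a_n'|² ≤ C N ∑_{N(n) ≤ N} |a_n|² τ(n)/N(n)` for all `N ≥ 1` and all complex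
coefficients.  Witness (module docstring): `N = K²`, `K = M³²`, `M = ⌈32¹⁷ max(C,1)⌉ + 1`, `a` = the
indicator of the rational integers `K/2 < k ≤ K`; left side `≥ (K/2)²`, right side
`≤ 8 max(C,1) K (1 + log K)¹⁶`.  Kernel-checked, standard axioms.  Harman's Lemma 11.1, the
"in particular" clause of Lemma 11.2, JT Lemma 3.2 first display and the corrected ray inequality
`sum_norm_rayCoeff_sq_le` are unaffected.
[cite: Harman2007, Lemma 11.2 p. 205] [cite: JarviniemiTeravainen2024, Lemma 3.2] -/
theorem not_Harman2007_lemma112_printed : ¬ Harman2007_lemma112_printed := by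
  rintro ⟨C, hC⟩
  -- a constant `C' ≥ 1` dominating `C`
  set C' : ℝ := max C 1 with hC'
  have hC'1 : 1 ≤ C' := le_max_right _ _
  have hC'0 : 0 ≤ C' := by linarith
  have hCC' : C ≤ C' := le_max_left _ _
  -- the parameters `M > 32¹⁷ C'` (e.g. `M = ⌈32¹⁷ C'⌉ + 1`), `K = M³²`, `N = K²`
  obtain ⟨M, hM1, hMC⟩ : ∃ M : ℕ, 1 ≤ M ∧ (32 : ℝ) ^ 17 * C' < M := by
    refine ⟨⌈(32 : ℝ) ^ 17 * C'⌉₊ + 1, by omega, ?_⟩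
    have := Nat.le_ceil ((32 : ℝ) ^ 17 * C')
    push_cast; linarith
  have hM1' : (1 : ℝ) ≤ M := by exact_mod_cast hM1
  obtain ⟨K, hK⟩ : ∃ K : ℕ, K = M ^ 32 := ⟨_, rfl⟩
  have hK1 : 1 ≤ K := hK ▸ Nat.one_le_pow _ _ hM1
  have hK0 : (0 : ℝ) < K := by exact_mod_cast hK1
  have hKM : (K : ℝ) = (M : ℝ) ^ 32 := by rw [hK]; push_cast; ring
  obtain ⟨N, hN⟩ : ∃ N : ℝ, N = (K : ℝ) ^ 2 := ⟨_, rfl⟩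
  have hN1 : 1 ≤ N := by
    have : (1 : ℝ) ≤ K := by exact_mod_cast hK1
    rw [hN]; nlinarith
  have hN0 : 0 ≤ N := by linarith
  -- the coefficients: indicator of the window `K/2 < k ≤ K` inside `ℤ[i]`
  set T : Finset GaussianInt := (Ioc (K / 2) K).image (Nat.cast : ℕ → GaussianInt) with hT
  set a : GaussianInt → ℂ := fun v ↦ if v ∈ T then 1 else 0 with ha
  have hTray : T ⊆ rayStar N 1 := by rw [hN]; exact image_Ioc_subset_rayStar K
  have hTnorm : T ⊆ normLEStar N := fun v hv ↦ (mem_rayStar.1 (hTray hv)).1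
  have hcardT : (K : ℝ) / 2 ≤ T.card := by
    rw [hT, card_image_of_injective _ Nat.cast_injective, Nat.card_Ioc,
      Nat.cast_sub (Nat.div_le_self K 2)]
    have h1 : ((K / 2 : ℕ) : ℝ) ≤ (K : ℝ) / 2 := Nat.cast_div_le
    linarith
  -- the printed inequality for these data
  have hmain := hC N a hN1
  -- the left side is at least `(K/2)²`
  have hL : (K : ℝ) ^ 2 / 4 ≤ ∑ n ∈ (normLEStar N).filter IsPrimitive, ‖rayCoeff N a n‖ ^ 2 := by
    have h1 : (1 : GaussianInt) ∈ (normLEStar N).filter IsPrimitive := by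
      rw [mem_filter, mem_normLEStar]
      refine ⟨⟨?_, by simp [mem_firstQuadrant]⟩, isPrimitive_one⟩
      simpa [Zsqrtd.norm_one] using hN1
    have h2 : ‖rayCoeff N a 1‖ ^ 2 = (T.card : ℝ) ^ 2 := by
      rw [ha, rayCoeff_one_indicator hTray, Complex.norm_natCast]
    have hK2 : (0 : ℝ) ≤ (K : ℝ) / 2 := by positivity
    calc (K : ℝ) ^ 2 / 4 = ((K : ℝ) / 2) ^ 2 := by ring
      _ ≤ (T.card : ℝ) ^ 2 := pow_le_pow_left₀ hK2 hcardT 2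
      _ = ‖rayCoeff N a 1‖ ^ 2 := h2.symm
      _ ≤ ∑ n ∈ (normLEStar N).filter IsPrimitive, ‖rayCoeff N a n‖ ^ 2 :=
          single_le_sum (f := fun n ↦ ‖rayCoeff N a n‖ ^ 2) (fun _ _ ↦ by positivity) h1
  -- the right side is at most `8 C' K (1 + log K)¹⁶`
  have hR : C * N * ∑ v ∈ normLEStar N, ‖a v‖ ^ 2 * ((divisorsStar v).card : ℝ) / (v.norm : ℝ) ≤
      8 * C' * K * (1 + Real.log K) ^ 16 := by
    have hsum : ∑ v ∈ normLEStar N, ‖a v‖ ^ 2 * ((divisorsStar v).card : ℝ) / (v.norm : ℝ) =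
        ∑ v ∈ T, ((divisorsStar v).card : ℝ) / (v.norm : ℝ) := by
      simp only [ha]
      exact sum_indicator_weight hTnorm
    have hsumT : ∑ v ∈ T, ((divisorsStar v).card : ℝ) / (v.norm : ℝ) =
        ∑ k ∈ Ioc (K / 2) K,
          ((divisorsStar (k : GaussianInt)).card : ℝ) / (((k : GaussianInt)).norm : ℝ) := by
      rw [hT, sum_image fun x _ y _ h ↦ Nat.cast_injective h]
    have hS0 : 0 ≤ ∑ v ∈ T, ((divisorsStar v).card : ℝ) / (v.norm : ℝ) :=
      sum_nonneg fun v _ ↦ div_nonneg (Nat.cast_nonneg _) (by exact_mod_cast GaussianInt.norm_nonneg v)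
    have hbound : ∑ v ∈ T, ((divisorsStar v).card : ℝ) / (v.norm : ℝ) ≤
        8 / K * (1 + Real.log K) ^ 16 := by
      rw [hsumT]; exact sum_window_card_divisorsStar_div_norm_le hK1
    rw [hsum]
    calc C * N * ∑ v ∈ T, ((divisorsStar v).card : ℝ) / (v.norm : ℝ)
        ≤ C' * N * ∑ v ∈ T, ((divisorsStar v).card : ℝ) / (v.norm : ℝ) :=
          mul_le_mul_of_nonneg_right (mul_le_mul_of_nonneg_right hCC' hN0) hS0
      _ ≤ C' * N * (8 / K * (1 + Real.log K) ^ 16) :=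
          mul_le_mul_of_nonneg_left hbound (mul_nonneg hC'0 hN0)
      _ = 8 * C' * K * (1 + Real.log K) ^ 16 := by
          rw [hN]; field_simp
  -- hence `K²/4 ≤ 8 C' K (1 + log K)¹⁶`
  have hineq : (K : ℝ) ^ 2 / 4 ≤ 8 * C' * K * (1 + Real.log K) ^ 16 := hL.trans (hmain.trans hR)
  -- `log K = 32 log M ≤ 32 (M - 1)`, so `(1 + log K)¹⁶ ≤ (32 M)¹⁶`
  have hM0 : (0 : ℝ) < M := by linarith
  have hlogK : 1 + Real.log K ≤ 32 * M := by
    have hlog : Real.log K = 32 * Real.log M := by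
      rw [hKM, Real.log_pow]; push_cast; ring
    have := Real.log_le_sub_one_of_pos hM0
    rw [hlog]; linarith
  have hlogK0 : 0 ≤ 1 + Real.log K := by
    have := Real.log_natCast_nonneg K
    linarith
  have hpow : (1 + Real.log K) ^ 16 ≤ (32 * (M : ℝ)) ^ 16 := pow_le_pow_left₀ hlogK0 hlogK 16
  -- so `K ≤ 32 C' (32 M)¹⁶ = 32¹⁷ C' M¹⁶`
  have hK_le : (K : ℝ) ≤ (32 : ℝ) ^ 17 * C' * (M : ℝ) ^ 16 := by
    have h8 : (0 : ℝ) ≤ 8 * C' * K := mul_nonneg (mul_nonneg (by norm_num) hC'0) hK0.le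
    have h4 : (K : ℝ) ^ 2 / 4 ≤ 8 * C' * K * (32 * (M : ℝ)) ^ 16 :=
      hineq.trans (mul_le_mul_of_nonneg_left hpow h8)
    have h5 : (K : ℝ) * K ≤ K * (32 * C' * (32 * (M : ℝ)) ^ 16) := by nlinarith [h4]
    have h6 := le_of_mul_le_mul_left h5 hK0
    calc (K : ℝ) ≤ 32 * C' * (32 * (M : ℝ)) ^ 16 := h6
      _ = (32 : ℝ) ^ 17 * C' * (M : ℝ) ^ 16 := by ring
  -- but `K = M³² ≥ M · M¹⁶ > 32¹⁷ C' M¹⁶`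
  have hM16 : (M : ℝ) ≤ (M : ℝ) ^ 16 := by
    calc (M : ℝ) = (M : ℝ) ^ 1 := (pow_one _).symm
      _ ≤ (M : ℝ) ^ 16 := pow_le_pow_right₀ hM1' (by norm_num)
  have hK_gt : (32 : ℝ) ^ 17 * C' * (M : ℝ) ^ 16 < K := by
    have hM16pos : (0 : ℝ) < (M : ℝ) ^ 16 := by positivity
    rw [hKM]
    calc (32 : ℝ) ^ 17 * C' * (M : ℝ) ^ 16 < M * (M : ℝ) ^ 16 := mul_lt_mul_of_pos_right hMC hM16pos
      _ ≤ (M : ℝ) ^ 16 * (M : ℝ) ^ 16 := mul_le_mul_of_nonneg_right hM16 hM16pos.le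
      _ = (M : ℝ) ^ 32 := by ring
  linarith

end Literature.NumberTheory.LFunctions.GaussianInt

end
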